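import Literature.Probability.Percolation.KSTPeriodicQuasiFence
import Literature.Probability.Percolation.KSTPeriodicNoSubpath
import HarnessLib

/-!
# KST-type RSW for periodic measures: Lemma 3, walls and crossers

Topic `Literature/Probability/Percolation`. The deterministic heart of the proof of
[KohlerSchindlerTassion2023, Lemma 3 and Comment 1] (arms give quasi-crossings, constant form
`QuasiOfArms` of `KSTPeriodicStatements.lean`), on top of the fences and walls of
`KSTPeriodicQuasiFence.lean`:

* `exists_mPathAt_of_crosser`: given two open walls of `H = R_t(m + b, m)` joined to the top and
  to the bottom row of a box `T ⊇ H`, every open left–right walk of `T` has a vertex joined inside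
  `T` to a vertex on an open `m`-path (it meets a wall or a connector, or by the corridor lemma
  `CorridorA` it contains an `m`-path);
* `quasiSides_of_arms`: two open fences of `H`, two long vertical connections with feet between
  the fences (from the top row of the big box down to the bottom row of `H`, and from the top row
  of `H` down to the bottom row of the big box) and open left–right crossings of the two
  overlapping halves of the big box realise both halves of the quasi-crossing.

## References

* [KohlerSchindlerTassion2023] L. Köhler-Schindler, V. Tassion, *Crossing probabilities for
  planar percolation*, Duke Math. J. 172 (2023) 809–838, §4.2 (Lemma 3), Lemma 2; Comment 1.
-/

namespace Literature.Probability.Percolation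

open LatticeModels SimpleGraph

noncomputable section

namespace KSTPeriodic

/-! ### The corridor step -/

/-- **The corridor step of Lemma 3.** Two open walls `γ₁`, `γ₂` of `H = R_t(m + b, m)` (walks
inside `H` from the upper to the lower target with open edges), a vertex of `γ₁` joined inside the
box `T = [L, R] × [B₀, T₀] ⊇ H` to the top row of `T` and a vertex of `γ₂` joined to its bottom
row, and an open left–right walk `χ` of `T`: then some vertex of `χ` is joined inside `T` to a
vertex on an open `m`-path — `χ` meets a wall or (the open witness of) a connector, or by
`CorridorA` some walk inside `H` between the targets uses only edges of `χ`, and its start is the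
required vertex. [cite: KohlerSchindlerTassion2023, §4.2, proof of Lemma 3 (use of Lemma 2)] -/
theorem exists_mPathAt_of_crosser (hCo : CorridorA) {ω : BondConfig (Site 2)}
    (hω : ω ⊆ (zdGraph 2).edgeSet) {t bb m : ℕ} (hm : 0 < m) (hbt : 0 < bb + t) {L R B₀ T₀ : ℤ}
    (hLx : L ≤ -((m : ℤ) + bb) - t) (hxR : (m : ℤ) + bb ≤ R) (hB₀ : B₀ ≤ -(m : ℤ) - t)
    (hT₀ : (m : ℤ) ≤ T₀) {g₁ h₁ : Site 2} (γ₁ : (zdGraph 2).Walk g₁ h₁)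
    (hγ₁ : ∀ z ∈ γ₁.support,
      -((m : ℤ) + bb) - t ≤ z 0 ∧ z 0 ≤ (m : ℤ) + bb ∧ -(m : ℤ) - t ≤ z 1 ∧ z 1 ≤ m)
    (hγ₁ω : ∀ e ∈ γ₁.edges, e ∈ ω) (hg₁ : -(bb : ℤ) - t ≤ g₁ 0 ∧ g₁ 0 ≤ bb ∧ g₁ 1 = m)
    (hh₁ : -(bb : ℤ) - t ≤ h₁ 0 ∧ h₁ 0 ≤ bb ∧ h₁ 1 = -(m : ℤ) - t) {c₁ d₁ : Site 2}
    (hc₁ : c₁ ∈ γ₁.support) (hd₁ : d₁ 1 = T₀) (hcd₁ : ω ∈ openConnIn (rect L R B₀ T₀) c₁ d₁)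
    {g₂ h₂ : Site 2} (γ₂ : (zdGraph 2).Walk g₂ h₂)
    (hγ₂ : ∀ z ∈ γ₂.support,
      -((m : ℤ) + bb) - t ≤ z 0 ∧ z 0 ≤ (m : ℤ) + bb ∧ -(m : ℤ) - t ≤ z 1 ∧ z 1 ≤ m)
    (hγ₂ω : ∀ e ∈ γ₂.edges, e ∈ ω) (hg₂ : -(bb : ℤ) - t ≤ g₂ 0 ∧ g₂ 0 ≤ bb ∧ g₂ 1 = m)
    (hh₂ : -(bb : ℤ) - t ≤ h₂ 0 ∧ h₂ 0 ≤ bb ∧ h₂ 1 = -(m : ℤ) - t) {c₂ d₂ : Site 2}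
    (hc₂ : c₂ ∈ γ₂.support) (hd₂ : d₂ 1 = B₀) (hcd₂ : ω ∈ openConnIn (rect L R B₀ T₀) c₂ d₂)
    {a b : Site 2} (χ : (zdGraph 2).Walk a b)
    (hχ : ∀ z ∈ χ.support, L ≤ z 0 ∧ z 0 ≤ R ∧ B₀ ≤ z 1 ∧ z 1 ≤ T₀) (hχω : ∀ e ∈ χ.edges, e ∈ ω)
    (ha : a 0 = L) (hb : b 0 = R) :
    ∃ z, MPathAt t bb m ω z ∧ ∃ w ∈ χ.support, ω ∈ openConnIn (rect L R B₀ T₀) z w := by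
  classical
  have hM₁ : ∀ z ∈ γ₁.support, MPathAt t bb m ω z := fun z hz =>
    mPathAt_of_mem_support γ₁ hg₁ hh₁ (fun x hx => hγ₁ x hx) hγ₁ω hz
  have hM₂ : ∀ z ∈ γ₂.support, MPathAt t bb m ω z := fun z hz =>
    mPathAt_of_mem_support γ₂ hg₂ hh₂ (fun x hx => hγ₂ x hx) hγ₂ω hz
  have hrefl : ∀ w ∈ χ.support, ω ∈ openConnIn (rect L R B₀ T₀) w w := fun w hw =>
    openConnIn_refl (show w ∈ rect L R B₀ T₀ from hχ w hw)
  obtain ⟨ζ₁, hζ₁S, hζ₁ω⟩ := exists_walk_of_mem_openConnIn hω hcd₁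
  obtain ⟨ζ₂, hζ₂S, hζ₂ω⟩ := exists_walk_of_mem_openConnIn hω hcd₂
  by_cases e₁ : ∃ z ∈ χ.support, z ∈ γ₁.support
  · obtain ⟨z, hzχ, hzγ⟩ := e₁
    exact ⟨z, hM₁ z hzγ, z, hzχ, hrefl z hzχ⟩
  by_cases e₂ : ∃ z ∈ χ.support, z ∈ ζ₁.support
  · obtain ⟨z, hzχ, hzζ⟩ := e₂
    exact ⟨c₁, hM₁ c₁ hc₁, z, hzχ, mem_openConnIn_of_mem_support ζ₁ hζ₁S hζ₁ω hzζ⟩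
  by_cases e₃ : ∃ z ∈ χ.support, z ∈ γ₂.support
  · obtain ⟨z, hzχ, hzγ⟩ := e₃
    exact ⟨z, hM₂ z hzγ, z, hzχ, hrefl z hzχ⟩
  by_cases e₄ : ∃ z ∈ χ.support, z ∈ ζ₂.support
  · obtain ⟨z, hzχ, hzζ⟩ := e₄
    exact ⟨c₂, hM₂ c₂ hc₂, z, hzχ, mem_openConnIn_of_mem_support ζ₂ hζ₂S hζ₂ω hzζ⟩
  push Not at e₁ e₂ e₃ e₄
  obtain ⟨p, q, κ, hp, hq, hκS, hκχ⟩ := hCo L R B₀ T₀ (-((m : ℤ) + bb) - t) ((m : ℤ) + bb)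
    (-(m : ℤ) - t) m (-(bb : ℤ) - t) bb hLx hxR hB₀ hT₀ (by omega) (by omega) (by omega) (by omega)
    a b χ hχ ha hb g₁ h₁ γ₁ hγ₁ hg₁ hh₁ c₁ d₁ ζ₁ (fun z hz => hζ₁S z hz) hc₁ hd₁
    g₂ h₂ γ₂ hγ₂ hg₂ hh₂ c₂ d₂ ζ₂ (fun z hz => hζ₂S z hz) hc₂ hd₂
    (fun z hz => ⟨e₁ z hz, e₂ z hz, e₃ z hz, e₄ z hz⟩)
  obtain ⟨hMp, hpχ⟩ := mPathAt_of_subwalk hm hχω κ hp hq (fun x hx => hκS x hx) hκχ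
  exact ⟨p, hMp, p, hpχ, hrefl p hpχ⟩

/-! ### The pathwise step -/

/-- **Lemma 3, pathwise.** With `H = R_t(m + b, m) = [x₁, x₂] × [B, T]`, a strip of columns
`[L, R]` (`L < x₁`, `x₂ < R`) inside the big box `[L', R'] × [B₀, T₀]`: an open left fence and an
open right fence of `H` (connections between the targets with endpoints at abscissae `≤ e_L`,
resp. `≥ e_R`), open connections inside `[L, R] × [B, T₀]` from the row `T₀` to the row `B` and
inside `[L, R] × [B₀, T]` from the row `T` to the row `B₀` whose ends on the rows of `H` have
abscissae strictly between `e_L` and `e_R`, and open left–right crossings of `[L', R] × [B₀, T₀]`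
and of `[L, R'] × [B₀, T₀]` together realise both halves of the quasi-crossing: an open `m`-path
joined inside the big box to its left column, and one joined to its right column.
[cite: KohlerSchindlerTassion2023, Lemma 3 (proof, §4.2)] -/
theorem quasiSides_of_arms (hTL : TopSideToLeftMeetsTB) (hTR : TopSideToRightMeetsTB)
    (hAlt : AlternatingTBMeet) (hCo : CorridorA) {ω : BondConfig (Site 2)}
    (hω : ω ⊆ (zdGraph 2).edgeSet) {t bb m : ℕ} (hm : 0 < m) (hbt : 0 < bb + t)
    {L R L' R' B₀ T₀ eL eR : ℤ} (hL' : L' ≤ L) (hLx : L < -((m : ℤ) + bb) - t)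
    (hxR : (m : ℤ) + bb < R) (hR' : R ≤ R') (hB₀ : B₀ ≤ -(m : ℤ) - t) (hT₀ : (m : ℤ) ≤ T₀)
    (hγL : ∃ g h : Site 2, ω ∈ openConnIn (mRegion t bb m) g h ∧ g 1 = m ∧ h 1 = -(m : ℤ) - t ∧
      -(bb : ℤ) - t ≤ g 0 ∧ g 0 ≤ eL ∧ -(bb : ℤ) - t ≤ h 0 ∧ h 0 ≤ eL)
    (hγR : ∃ g h : Site 2, ω ∈ openConnIn (mRegion t bb m) g h ∧ g 1 = m ∧ h 1 = -(m : ℤ) - t ∧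
      eR ≤ g 0 ∧ g 0 ≤ bb ∧ eR ≤ h 0 ∧ h 0 ≤ bb)
    (hπT : ∃ x y : Site 2, ω ∈ openConnIn (rect L R (-(m : ℤ) - t) T₀) x y ∧ x 1 = T₀ ∧
      y 1 = -(m : ℤ) - t ∧ eL < y 0 ∧ y 0 < eR)
    (hπB : ∃ x y : Site 2, ω ∈ openConnIn (rect L R B₀ m) x y ∧ x 1 = m ∧ y 1 = B₀ ∧
      eL < x 0 ∧ x 0 < eR)
    (hχL : ∃ x y : Site 2, ω ∈ openConnIn (rect L' R B₀ T₀) x y ∧ x 0 = L' ∧ y 0 = R)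
    (hχR : ∃ x y : Site 2, ω ∈ openConnIn (rect L R' B₀ T₀) x y ∧ x 0 = L ∧ y 0 = R') :
    (∃ z, MPathAt t bb m ω z ∧ ∃ l, l ∈ rect L' R' B₀ T₀ ∧ l 0 = L' ∧
      ω ∈ openConnIn (rect L' R' B₀ T₀) z l) ∧
    (∃ z, MPathAt t bb m ω z ∧ ∃ r, r ∈ rect L' R' B₀ T₀ ∧ r 0 = R' ∧
      ω ∈ openConnIn (rect L' R' B₀ T₀) z r) := by
  classical
  obtain ⟨gL, kL, hcL, hgL1, hkL1, hgL0, hgLe, hkL0, hkLe⟩ := hγL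
  obtain ⟨gR, kR, hcR, hgR1, hkR1, hgRe, hgR0, hkRe, hkR0⟩ := hγR
  obtain ⟨xT, yT, hcT, hxT1, hyT1, hyTl, hyTr⟩ := hπT
  obtain ⟨xB, yB, hcB, hxB1, hyB1, hxBl, hxBr⟩ := hπB
  obtain ⟨γ₁, hγ₁S, hγ₁ω⟩ := exists_walk_of_mem_openConnIn hω hcL
  obtain ⟨γ₂, hγ₂S, hγ₂ω⟩ := exists_walk_of_mem_openConnIn hω hcR
  have hγ₁S' : ∀ z ∈ γ₁.support,
      -((m : ℤ) + bb) - t ≤ z 0 ∧ z 0 ≤ (m : ℤ) + bb ∧ -(m : ℤ) - t ≤ z 1 ∧ z 1 ≤ m :=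
    fun z hz => hγ₁S z hz
  have hγ₂S' : ∀ z ∈ γ₂.support,
      -((m : ℤ) + bb) - t ≤ z 0 ∧ z 0 ≤ (m : ℤ) + bb ∧ -(m : ℤ) - t ≤ z 1 ∧ z 1 ≤ m :=
    fun z hz => hγ₂S z hz
  have hg₁ : -(bb : ℤ) - t ≤ gL 0 ∧ gL 0 ≤ bb ∧ gL 1 = m := ⟨hgL0, by omega, hgL1⟩
  have hh₁ : -(bb : ℤ) - t ≤ kL 0 ∧ kL 0 ≤ bb ∧ kL 1 = -(m : ℤ) - t := ⟨hkL0, by omega, hkL1⟩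
  have hg₂ : -(bb : ℤ) - t ≤ gR 0 ∧ gR 0 ≤ bb ∧ gR 1 = m := ⟨by omega, hgR0, hgR1⟩
  have hh₂ : -(bb : ℤ) - t ≤ kR 0 ∧ kR 0 ≤ bb ∧ kR 1 = -(m : ℤ) - t := ⟨by omega, hkR0, hkR1⟩
  -- the wall joined to the top row and the wall joined to the bottom row
  obtain ⟨g₁', h₁', W₁, hW₁g, hW₁h, hW₁S, hW₁ω, c₁, hc₁, hc₁x⟩ :=
    exists_wall_top hTL hTR hAlt hω hLx hxR (by omega) hB₀ hT₀ γ₁ γ₂ hγ₁S' hγ₁ω hg₁ hh₁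
      hγ₂S' hγ₂ω hg₂ hh₂ hxT1 hyT1 (by omega) (by omega) hcT
  obtain ⟨g₂', h₂', W₂, hW₂g, hW₂h, hW₂S, hW₂ω, c₂, hc₂, hc₂y⟩ :=
    exists_wall_bot hTL hTR hAlt hω hLx hxR (by omega) hB₀ hT₀ γ₁ γ₂ hγ₁S' hγ₁ω hg₁ hh₁
      hγ₂S' hγ₂ω hg₂ hh₂ hxB1 (by omega) (by omega) hyB1 hcB
  have hTB : rect L R B₀ T₀ ⊆ rect L' R' B₀ T₀ := rect_mono hL' hR' le_rfl le_rfl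
  constructor
  · -- the crossing from the left, after its last visit to the column `L`
    obtain ⟨xl, yl, hl, hxl0, hyl0⟩ := hχL
    have hl' : ω ∈ openConnIn (rect L' R B₀ T₀) yl xl := by rwa [openConnIn_comm]
    obtain ⟨v, hv0, hyv⟩ := exists_openConnIn_column_ge hω L (by omega) (by omega) hl'
    have hsub : rect L' R B₀ T₀ ∩ {z : Site 2 | L ≤ z 0} ⊆ rect L R B₀ T₀ :=
      fun z hz => ⟨hz.2, hz.1.2.1, hz.1.2.2.1, hz.1.2.2.2⟩
    obtain ⟨χ₀, hχ₀S, hχ₀ω⟩ := exists_walk_of_mem_openConnIn hω (openConnIn_mono hsub _ _ hyv)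
    have hχS : ∀ z ∈ χ₀.reverse.support, L ≤ z 0 ∧ z 0 ≤ R ∧ B₀ ≤ z 1 ∧ z 1 ≤ T₀ := by
      intro z hz
      rw [Walk.support_reverse, List.mem_reverse] at hz
      exact hχ₀S z hz
    have hχω : ∀ e ∈ χ₀.reverse.edges, e ∈ ω := by
      intro e he
      rw [Walk.edges_reverse, List.mem_reverse] at he
      exact hχ₀ω e he
    obtain ⟨z, hMz, w, hw, hzw⟩ := exists_mPathAt_of_crosser hCo hω hm hbt hLx.le hxR.le hB₀ hT₀
      W₁ hW₁S hW₁ω hW₁g hW₁h hc₁ hxT1 hc₁x W₂ hW₂S hW₂ω hW₂g hW₂h hc₂ hyB1 hc₂y χ₀.reverse hχS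
      hχω hv0 hyl0
    have hw' : w ∈ χ₀.support := by rw [Walk.support_reverse, List.mem_reverse] at hw; exact hw
    have h1 : ω ∈ openConnIn (rect L R B₀ T₀) yl w := mem_openConnIn_of_mem_support χ₀ hχ₀S hχ₀ω hw'
    rw [openConnIn_comm] at h1
    have hbig : rect L' R B₀ T₀ ⊆ rect L' R' B₀ T₀ := rect_mono le_rfl hR' le_rfl le_rfl
    exact ⟨z, hMz, xl, hbig hl'.2.1, hxl0, PlanarDuality.openConnIn_trans (openConnIn_mono hTB _ _ hzw)
      (PlanarDuality.openConnIn_trans (openConnIn_mono hTB _ _ h1) (openConnIn_mono hbig _ _ hl'))⟩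
  · -- the crossing from the right, up to its first visit to the column `R`
    obtain ⟨xr, yr, hr, hxr0, hyr0⟩ := hχR
    obtain ⟨v, hv0, hxv⟩ := exists_openConnIn_column hω R (by omega) (by omega) hr
    have hsub : rect L R' B₀ T₀ ∩ {z : Site 2 | z 0 ≤ R} ⊆ rect L R B₀ T₀ :=
      fun z hz => ⟨hz.1.1, hz.2, hz.1.2.2.1, hz.1.2.2.2⟩
    obtain ⟨χ, hχS, hχω⟩ := exists_walk_of_mem_openConnIn hω (openConnIn_mono hsub _ _ hxv)
    obtain ⟨z, hMz, w, hw, hzw⟩ := exists_mPathAt_of_crosser hCo hω hm hbt hLx.le hxR.le hB₀ hT₀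
      W₁ hW₁S hW₁ω hW₁g hW₁h hc₁ hxT1 hc₁x W₂ hW₂S hW₂ω hW₂g hW₂h hc₂ hyB1 hc₂y χ
      (fun z hz => hχS z hz) hχω hxr0 hv0
    have h1 : ω ∈ openConnIn (rect L R B₀ T₀) xr w := mem_openConnIn_of_mem_support χ hχS hχω hw
    rw [openConnIn_comm] at h1
    have hbig : rect L R' B₀ T₀ ⊆ rect L' R' B₀ T₀ := rect_mono hL' le_rfl le_rfl le_rfl
    exact ⟨z, hMz, yr, hbig hr.2.1, hyr0, PlanarDuality.openConnIn_trans (openConnIn_mono hTB _ _ hzw)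
      (PlanarDuality.openConnIn_trans (openConnIn_mono hTB _ _ h1) (openConnIn_mono hbig _ _ hr))⟩

end KSTPeriodic

end

end Literature.Probability.Percolation
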